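import Summits.BirchSwinnertonDyer.BirchSwinnertonDyer.Theorems.ManinLocalTwoThreeUDCGlueTwo
import Summits.BirchSwinnertonDyer.BirchSwinnertonDyer.Theorems.ManinLocalTwoThreeSigmaSqRootKummerShimuraTwo
import Summits.BirchSwinnertonDyer.BirchSwinnertonDyer.Theorems.ManinLocalTwoThreeShimuraQuotientLevelInstances
import HarnessLib

/-!
# TWO RATIONAL 2-DIVISION ROOTS: an even Manin constant would put `Λ₁(f)` in the lines of BOTH half-periods, i.e. force INDEX 4 — so C2 holds for curves with
# full rational `2`-torsion wherever E-an-152b (index `≠ 4`) is a theorem, modulo the ℓ = 2 witness law AN2₂ ∧ CDT (no cusp facts, no blindness)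
(route `ManinLocalTwoThree`, deciding crux C2 `ManinOddAtFour` stmt-BirchSwinnertonDyer-22967; cell bsd-f2-manin, C2/C3 LEAD p1 gen 18; `--supports stmt-BirchSwinnertonDyer-22967`;
combines p2 g19's ℓ = 2 UDC chain (`…UDCGlueTwo`: BI₂ + AN3₂ glue + NC₂-glue) with the LEAD's Kummer–Shimura₂ (`…SigmaSqRootKummerShimuraTwo`, p746594))

THE MECHANISM.  For EACH rational `2`-division root `e` with half-period `p`, `2 ∣ c` ⟹ (BI₂) a `2`-adically integral `√Ξ_T` ⟹ (AN2₂, the witness law — binder `hWL`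
VERBATIM as in `UDCGlueTwo.periodLatticeGamma1_ne_of_two_dvd_of_sqRootWitnessLaw`) a witness with stabiliser `Γ_{V_p}` ⟹ (UDW ⟸ CDT) congruence ⟹ (p2's NC₂-glue, Kurth–Long)
**`V_p` is `Γ₁(N)`-periodic** (§1: the intermediate conclusion p2's glue passes through, exposed).  With TWO roots `e ≠ e′` (half-periods `p`, `p′`, `p − p′ ∉ Λ` since
`℘(p) ≠ ℘(p′)`), the LEAD's `periodLatticeGamma1_eq_two_mul_of_two_halfPeriods` gives **`Λ₁(f) = 2Λ₀(f)` (index 4)** at `4 ∣ N` (§2).  Hence (§3) **`2 ∤ c` for every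
lattice-optimal datum of a globally minimal curve with two rational `2`-division roots at any level where index 4 is excluded** — unconditionally so at the E-an-152b
theorem levels of `…ShimuraQuotientLevelInstances` / `…QuarterShiftGamma1Orbit` (e.g. `N ∈ {32, 64, 128, 256}`, `8p`, `16p`), and in general modulo E-an-152b.
So on the GAIN locus the three v25 laws are needed only for curves with EXACTLY ONE rational `2`-division root.
HONEST FRAMING: CONDITIONAL on the witness law AN2₂ (p2 g19 assembling it as a theorem) and on UDW/CDT (printed); C2, Manin's conjecture and BSD are NOT proved.
No definitions, no sorry.
[cite: CalegariDimitrovTang2025, Thm. 1.0.1 and Remarks 58–59] [cite: KurthLong2008, Prop. 18] [cite: Stevens1989, §2] [cite: LingOesterle1991, Thm. 6]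
-/

set_option autoImplicit false
-- lint-debt: the directory name repeats the summit name (sibling precedent `ManinLocalTwoThreeUDCGlueTwo.lean`)
set_option linter.dupNamespace false

noncomputable section

open PowerSeries CongruenceSubgroup Complex
open scoped MatrixGroups ModularForm Manifold PeriodPair
open WeierstrassCurve Literature.NumberTheory.EllipticCurves Literature.NumberTheory.EllipticCurves.ModularForms
open Summit.BirchSwinnertonDyer.Rank1Residual.ManinAdditive
open Summit.BirchSwinnertonDyer.Rank1Residual.ManinAdditive.CuspidalKummer
open Summit.BirchSwinnertonDyer.Rank1Residual.ManinAdditive.UDCKummerLineK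
open Summit.BirchSwinnertonDyer.BirchSwinnertonDyer.Theorems.ManinLocalTwoThree.SigmaSquareRoot
open Summit.BirchSwinnertonDyer.BirchSwinnertonDyer.Theorems.ManinLocalTwoThree.SigmaHabitat
open Summit.BirchSwinnertonDyer.BirchSwinnertonDyer.Theorems.ManinLocalTwoThree.UDCTwo
open Summit.BirchSwinnertonDyer.BirchSwinnertonDyer.Theorems.ManinLocalTwoThree.KummerSqRootBounded

namespace Summit.BirchSwinnertonDyer.BirchSwinnertonDyer.Theorems.ManinLocalTwoThree.FullTwoTorsion

variable {W : WeierstrassCurve ℚ} [W.IsElliptic] [W.IsGloballyMinimal] {N : ℕ} [NeZero N]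

/-! ## §1 `2 ∣ c` ⟹ `V_p` is `Γ₁(N)`-periodic, for EVERY rational `2`-division root (AN2₂ ∧ UDW) -/

/-- **`2 ∣ c` ⟹ the `σ`-square root of the given root's half-period is `Γ₁(N)`-periodic** (`4 ∣ N`, lattice-optimal, `p ∉ Λ`, `2p = m₁ω₁ + m₂ω₂`, `x_s(T) = c²℘(p)`):
BI₂ ⟹ AN2₂-witness ⟹ UDW-congruence ⟹ Kurth–Long.  CONDITIONAL on `hWL`, `hUDW`. [cite: CalegariDimitrovTang2025, Thm. 1.0.1] [cite: KurthLong2008, Prop. 18] -/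
theorem sigmaSqRoot_gamma1_periodic_of_two_dvd_of_sqRootWitnessLaw
    (hWL : ∀ (W : WeierstrassCurve ℚ) [W.IsElliptic] [W.IsGloballyMinimal] {N : ℕ} [NeZero N]
      (D : ModularParametrizationData W N) (a : ℕ → ℤ), (∀ n, (a n : ℂ) = cuspCoeff D.f n) → 4 ∣ N →
      (∀ z ∈ D.L.lattice, ∃ w ∈ periodLattice D.f, z = D.c * w) →
      ∀ e : ℚ, W.twoTorsionPolynomial.toPoly.IsRoot e →
      ∀ (p : ℂ) (m₁ m₂ : ℤ), p ∉ D.L.lattice → 2 * p = m₁ * D.L.ω₁ + m₂ * D.L.ω₂ →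
      ((shortRoot W D.c e : ℚ) : ℂ) = (D.c : ℂ) ^ 2 * ℘[D.L] p →
      ∀ z : ℚ⟦X⟧, IsParamGerm W D.c a z →
      ∀ h : ℚ⟦X⟧, h ^ 2 = kummerSeries W D.c e z → constantCoeff h = 1 → (∀ n : ℕ, ¬ (2 ∣ (coeff n h).den)) →
      ∃ (k : ℤ) (F : UpperHalfPlane → ℂ), MDifferentiable 𝓘(ℂ) 𝓘(ℂ) F ∧
        (∀ γ : Gamma0 N, (∀ w : ℂ, sigmaSqRoot D.L p (m₁ * D.L.η₁ + m₂ * D.L.η₂) (w + (D.c : ℂ) * cuspSymbol D.f γ) =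
          sigmaSqRoot D.L p (m₁ * D.L.η₁ + m₂ * D.L.η₂) w) → F ∣[k] (γ : SL(2, ℤ)) = F) ∧
        (∀ γ : Gamma0 N, F ∣[k] (γ : SL(2, ℤ)) = F → ∀ w : ℂ,
          sigmaSqRoot D.L p (m₁ * D.L.η₁ + m₂ * D.L.η₂) (w + (D.c : ℂ) * cuspSymbol D.f γ) =
            sigmaSqRoot D.L p (m₁ * D.L.η₁ + m₂ * D.L.η₂) w) ∧
        (∀ g : SL(2, ℤ), ∃ C A m : ℝ, ∀ τ : UpperHalfPlane, A ≤ τ.im → ‖(F ∣[k] g) τ‖ ≤ C * Real.exp (m * τ.im)) ∧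
        (∃ b : ℕ → ℂ, (∀ n, IsIntegral ℤ (b n)) ∧ ∀ τ : UpperHalfPlane,
          HasSum (fun n : ℕ ↦ b n * Complex.exp (2 * Real.pi * Complex.I * (τ : ℂ) * n)) (F τ)))
    (hUDW : ∀ k : ℤ, UnboundedDenominatorsWeightAlgInt k)
    (D : ModularParametrizationData W N) (h4 : 4 ∣ N) (hopt : ∀ z ∈ D.L.lattice, ∃ w ∈ periodLattice D.f, z = D.c * w)
    {e : ℚ} (he : W.twoTorsionPolynomial.toPoly.IsRoot e) {p : ℂ} {m₁ m₂ : ℤ} (hp : p ∉ D.L.lattice)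
    (hm : 2 * p = m₁ * D.L.ω₁ + m₂ * D.L.ω₂) (hX : ((shortRoot W D.c e : ℚ) : ℂ) = (D.c : ℂ) ^ 2 * ℘[D.L] p)
    (h2c : (2 : ℤ) ∣ D.c) :
    ∀ γ : Gamma1 N, ∀ w : ℂ,
      sigmaSqRoot D.L p (m₁ * D.L.η₁ + m₂ * D.L.η₂) (w + (D.c : ℂ) * cuspSymbol D.f ⟨(γ : SL(2, ℤ)), Gamma1_in_Gamma0 N γ.2⟩) =
        sigmaSqRoot D.L p (m₁ * D.L.η₁ + m₂ * D.L.η₂) w := by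
  set a : ℕ → ℤ := fun n ↦ W.LFunction n with ha_def
  have ha : ∀ n, (a n : ℂ) = cuspCoeff D.f n := fun n ↦ (D.isNewformOf.2 n).symm
  obtain ⟨z, hz⟩ := exists_isParamGerm W D.c a
  obtain ⟨h, hh2, hh0, hint⟩ := kummerSqRoot_twoAdicallyIntegral W D a ha h4 e he z hz h2c
  obtain ⟨k, F, hhol, hinv, hstab, hgrowth, hq⟩ := hWL W D a ha h4 hopt e he p m₁ m₂ hp hm hX z hz h hh2 hh0 hint
  obtain ⟨Γ, hmem, hle, hfi, -, -⟩ := exists_sigmaSqRootPeriodSubgroup D hopt hp hm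
  have hΓinv : ∀ γ ∈ Γ, F ∣[k] γ = F := by
    intro γ hγ
    have hγ0 : γ ∈ Gamma0 N := hle hγ
    exact hinv ⟨γ, hγ0⟩ ((hmem ⟨γ, hγ0⟩).mp hγ)
  obtain ⟨M, hM, hcong⟩ := hUDW k Γ hfi F hhol hΓinv hgrowth hq
  exact sigmaSqRoot_gamma1_periodic_of_congruence D hopt hp hm hM fun γ hγ ↦ hstab γ (hcong _ hγ)

/-! ## §2 Two roots ⟹ index 4 -/

omit [W.IsElliptic] [W.IsGloballyMinimal] in
/-- Distinct roots have half-periods differing off the lattice: `℘(p) ≠ ℘(p′)` ⟹ `p − p′ ∉ Λ`. [folklore] -/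
theorem sub_notMem_lattice_of_shortRoot_ne (D : ModularParametrizationData W N) {e e' : ℚ} (hne : e ≠ e') {p p' : ℂ}
    (hX : ((shortRoot W D.c e : ℚ) : ℂ) = (D.c : ℂ) ^ 2 * ℘[D.L] p) (hX' : ((shortRoot W D.c e' : ℚ) : ℂ) = (D.c : ℂ) ^ 2 * ℘[D.L] p') :
    p - p' ∉ D.L.lattice := by
  intro hmem
  apply hne
  have h℘ : ℘[D.L] p = ℘[D.L] p' := by
    have h1 : ℘[D.L] (p' + (p - p')) = ℘[D.L] p' := by simpa using D.L.weierstrassP_add_coe p' ⟨p - p', hmem⟩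
    rwa [show p' + (p - p') = p by ring] at h1
  have hs : ((shortRoot W D.c e : ℚ) : ℂ) = ((shortRoot W D.c e' : ℚ) : ℂ) := by rw [hX, hX', h℘]
  have hs' : shortRoot W D.c e = shortRoot W D.c e' := by exact_mod_cast hs
  have hc : (D.c : ℚ) ≠ 0 := by exact_mod_cast D.maninConstant_ne_zero_holds
  unfold shortRoot at hs'
  have := mul_left_cancel₀ (pow_ne_zero 2 hc) hs'
  linarith

/-- **TWO rational `2`-division roots and `2 ∣ c` force INDEX 4** (`Λ₁(f) = 2Λ₀(f)`) at `4 ∣ N`, modulo AN2₂ ∧ UDW: both `σ`-square roots are `Γ₁(N)`-periodic (§1), and the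
LEAD's `periodLatticeGamma1_eq_two_mul_of_two_halfPeriods` (p746594). [cite: Stevens1989, §2] [cite: KurthLong2008, Prop. 18] -/
theorem periodLatticeGamma1_eq_two_mul_of_two_dvd_of_two_roots
    (hWL : ∀ (W : WeierstrassCurve ℚ) [W.IsElliptic] [W.IsGloballyMinimal] {N : ℕ} [NeZero N]
      (D : ModularParametrizationData W N) (a : ℕ → ℤ), (∀ n, (a n : ℂ) = cuspCoeff D.f n) → 4 ∣ N →
      (∀ z ∈ D.L.lattice, ∃ w ∈ periodLattice D.f, z = D.c * w) →
      ∀ e : ℚ, W.twoTorsionPolynomial.toPoly.IsRoot e →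
      ∀ (p : ℂ) (m₁ m₂ : ℤ), p ∉ D.L.lattice → 2 * p = m₁ * D.L.ω₁ + m₂ * D.L.ω₂ →
      ((shortRoot W D.c e : ℚ) : ℂ) = (D.c : ℂ) ^ 2 * ℘[D.L] p →
      ∀ z : ℚ⟦X⟧, IsParamGerm W D.c a z →
      ∀ h : ℚ⟦X⟧, h ^ 2 = kummerSeries W D.c e z → constantCoeff h = 1 → (∀ n : ℕ, ¬ (2 ∣ (coeff n h).den)) →
      ∃ (k : ℤ) (F : UpperHalfPlane → ℂ), MDifferentiable 𝓘(ℂ) 𝓘(ℂ) F ∧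
        (∀ γ : Gamma0 N, (∀ w : ℂ, sigmaSqRoot D.L p (m₁ * D.L.η₁ + m₂ * D.L.η₂) (w + (D.c : ℂ) * cuspSymbol D.f γ) =
          sigmaSqRoot D.L p (m₁ * D.L.η₁ + m₂ * D.L.η₂) w) → F ∣[k] (γ : SL(2, ℤ)) = F) ∧
        (∀ γ : Gamma0 N, F ∣[k] (γ : SL(2, ℤ)) = F → ∀ w : ℂ,
          sigmaSqRoot D.L p (m₁ * D.L.η₁ + m₂ * D.L.η₂) (w + (D.c : ℂ) * cuspSymbol D.f γ) =
            sigmaSqRoot D.L p (m₁ * D.L.η₁ + m₂ * D.L.η₂) w) ∧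
        (∀ g : SL(2, ℤ), ∃ C A m : ℝ, ∀ τ : UpperHalfPlane, A ≤ τ.im → ‖(F ∣[k] g) τ‖ ≤ C * Real.exp (m * τ.im)) ∧
        (∃ b : ℕ → ℂ, (∀ n, IsIntegral ℤ (b n)) ∧ ∀ τ : UpperHalfPlane,
          HasSum (fun n : ℕ ↦ b n * Complex.exp (2 * Real.pi * Complex.I * (τ : ℂ) * n)) (F τ)))
    (hUDW : ∀ k : ℤ, UnboundedDenominatorsWeightAlgInt k)
    (D : ModularParametrizationData W N) (h4 : 2 ^ 2 ∣ N) (hopt : ∀ z ∈ D.L.lattice, ∃ w ∈ periodLattice D.f, z = D.c * w)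
    {e e' : ℚ} (he : W.twoTorsionPolynomial.toPoly.IsRoot e) (he' : W.twoTorsionPolynomial.toPoly.IsRoot e') (hne : e ≠ e')
    (h2c : (2 : ℤ) ∣ D.c) :
    ∀ z : ℂ, z ∈ periodLatticeGamma1 D.f ↔ ∃ w ∈ periodLattice D.f, z = 2 * w := by
  have h4' : 4 ∣ N := by norm_num at h4; exact h4
  obtain ⟨p, hp, h2p, h℘⟩ := exists_halfPeriod_of_twoTorsion_root D he
  obtain ⟨p', hp', h2p', h℘'⟩ := exists_halfPeriod_of_twoTorsion_root D he'
  have hX := shortRoot_eq_of_weierstrassP_eq W D.c h℘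
  have hX' := shortRoot_eq_of_weierstrassP_eq W D.c h℘'
  obtain ⟨m₁, m₂, hm⟩ := PeriodPair.mem_lattice.mp h2p
  obtain ⟨m₁', m₂', hm'⟩ := PeriodPair.mem_lattice.mp h2p'
  exact periodLatticeGamma1_eq_two_mul_of_two_halfPeriods D hopt h4 hp hm.symm hp' hm'.symm
    (sub_notMem_lattice_of_shortRoot_ne D hne hX hX')
    (sigmaSqRoot_gamma1_periodic_of_two_dvd_of_sqRootWitnessLaw hWL hUDW D h4' hopt he hp hm.symm hX h2c)
    (sigmaSqRoot_gamma1_periodic_of_two_dvd_of_sqRootWitnessLaw hWL hUDW D h4' hopt he' hp' hm'.symm hX' h2c)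

/-! ## §3 C2 for two rational roots wherever index 4 is excluded -/

/-- **C2 for curves with TWO rational `2`-division roots, modulo AN2₂ ∧ UDW ∧ «index ≠ 4»**: a lattice-optimal datum at `4 ∣ N` of a globally minimal curve with
`e ≠ e′` both roots of the `2`-division cubic and `Λ₁(f) ≠ 2Λ₀(f)` has `2 ∤ c`. [cite: CalegariDimitrovTang2025, Thm. 1.0.1] [cite: Stevens1989, §2] -/
theorem not_two_dvd_maninConstant_of_two_roots_of_not_indexFour
    (hWL : ∀ (W : WeierstrassCurve ℚ) [W.IsElliptic] [W.IsGloballyMinimal] {N : ℕ} [NeZero N]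
      (D : ModularParametrizationData W N) (a : ℕ → ℤ), (∀ n, (a n : ℂ) = cuspCoeff D.f n) → 4 ∣ N →
      (∀ z ∈ D.L.lattice, ∃ w ∈ periodLattice D.f, z = D.c * w) →
      ∀ e : ℚ, W.twoTorsionPolynomial.toPoly.IsRoot e →
      ∀ (p : ℂ) (m₁ m₂ : ℤ), p ∉ D.L.lattice → 2 * p = m₁ * D.L.ω₁ + m₂ * D.L.ω₂ →
      ((shortRoot W D.c e : ℚ) : ℂ) = (D.c : ℂ) ^ 2 * ℘[D.L] p →
      ∀ z : ℚ⟦X⟧, IsParamGerm W D.c a z →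
      ∀ h : ℚ⟦X⟧, h ^ 2 = kummerSeries W D.c e z → constantCoeff h = 1 → (∀ n : ℕ, ¬ (2 ∣ (coeff n h).den)) →
      ∃ (k : ℤ) (F : UpperHalfPlane → ℂ), MDifferentiable 𝓘(ℂ) 𝓘(ℂ) F ∧
        (∀ γ : Gamma0 N, (∀ w : ℂ, sigmaSqRoot D.L p (m₁ * D.L.η₁ + m₂ * D.L.η₂) (w + (D.c : ℂ) * cuspSymbol D.f γ) =
          sigmaSqRoot D.L p (m₁ * D.L.η₁ + m₂ * D.L.η₂) w) → F ∣[k] (γ : SL(2, ℤ)) = F) ∧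
        (∀ γ : Gamma0 N, F ∣[k] (γ : SL(2, ℤ)) = F → ∀ w : ℂ,
          sigmaSqRoot D.L p (m₁ * D.L.η₁ + m₂ * D.L.η₂) (w + (D.c : ℂ) * cuspSymbol D.f γ) =
            sigmaSqRoot D.L p (m₁ * D.L.η₁ + m₂ * D.L.η₂) w) ∧
        (∀ g : SL(2, ℤ), ∃ C A m : ℝ, ∀ τ : UpperHalfPlane, A ≤ τ.im → ‖(F ∣[k] g) τ‖ ≤ C * Real.exp (m * τ.im)) ∧
        (∃ b : ℕ → ℂ, (∀ n, IsIntegral ℤ (b n)) ∧ ∀ τ : UpperHalfPlane,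
          HasSum (fun n : ℕ ↦ b n * Complex.exp (2 * Real.pi * Complex.I * (τ : ℂ) * n)) (F τ)))
    (hUDW : ∀ k : ℤ, UnboundedDenominatorsWeightAlgInt k)
    (D : ModularParametrizationData W N) (h4 : 2 ^ 2 ∣ N) (hopt : ∀ z ∈ D.L.lattice, ∃ w ∈ periodLattice D.f, z = D.c * w)
    {e e' : ℚ} (he : W.twoTorsionPolynomial.toPoly.IsRoot e) (he' : W.twoTorsionPolynomial.toPoly.IsRoot e') (hne : e ≠ e')
    (hidx : ¬ ∀ z : ℂ, z ∈ periodLatticeGamma1 D.f ↔ ∃ w ∈ periodLattice D.f, z = 2 * w) :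
    ¬ (2 : ℤ) ∣ D.maninConstant :=
  fun h2c ↦ hidx (periodLatticeGamma1_eq_two_mul_of_two_dvd_of_two_roots hWL hUDW D h4 hopt he he' hne h2c)

end Summit.BirchSwinnertonDyer.BirchSwinnertonDyer.Theorems.ManinLocalTwoThree.FullTwoTorsion

end
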